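import Literature.Analysis.FunctionSpaces.PeriodicLogCost
import HarnessLib

/-!
# The periodic squared-sine distance and the logarithmic cost: derivatives

Analysis/FunctionSpaces support file (everything proved). Partial derivatives, gradient and
Laplacian bounds for `S(z) = ∑ᵢ sin²(π zᵢ)` (`Torus.sinSqSum`) and for the smooth logarithmic
cost `Φ_δ = log(1 + S/δ²)` (`Torus.sinLogCost`) of `PeriodicLogCost`:

* `∂ⱼ S = π sin(2π zⱼ)`, `∂ⱼ∂ⱼ S = 2π² cos(2π zⱼ) ≤ 2π²`, `∑ⱼ (∂ⱼS)² ≤ 4π² S`, `∇S` odd;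
* `∇Φ_δ = (δ⁻²/(1 + S/δ²)) ∇S` (odd), the **transport bound** `‖z‖ · ‖∇Φ_δ(z)‖ ≤ π`, and the
  **diffusion bound** `ΔΦ_δ ≤ 2π² d/δ²`.

These are the two pointwise inequalities that make the two-point functional `∫∫ Φ_δ(x - y) dπ`
grow at most like `∫ (‖∇u‖_{L²} + 1) dt` along an incompressible advection–diffusion with
`δ² = κ` (Crippa–De Lellis 2008, §2; Seis, arXiv:2003.08794, Lemma 3).

## References

* G. Crippa, C. De Lellis, J. reine angew. Math. 616 (2008), §2.
* C. Seis, Comm. Math. Phys. 399 (2023) = arXiv:2003.08794, Lemma 3. [`Seis2022`]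
-/

noncomputable section

open MeasureTheory Set Filter Topology Function Real
open scoped InnerProductSpace ContDiff

namespace Literature.Analysis.FunctionSpaces

namespace Torus

variable {d : Type*} [Fintype d] [DecidableEq d]

/-! ## Partial derivatives along coordinate lines -/


omit [Fintype d] [DecidableEq d] in
/-- Coordinates along the `j`-th coordinate line through `z`. [folklore] -/
theorem line_apply [Fintype d] [DecidableEq d] (z : UnitAddTorus d) (j i : d) (t : ℝ) :
    (z + proj (t • EuclideanSpace.single j (1 : ℝ))) i = z i + (((if i = j then t else 0 : ℝ)) : UnitAddCircle) := by
  simp only [Pi.add_apply, proj_apply', PiLp.smul_apply, PiLp.single_apply, smul_eq_mul, mul_ite,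
    mul_one, mul_zero]

/-- **`∂ⱼ cos(2π zᵢ)`**: `-2π sin(2π zⱼ)` if `i = j`, else `0`. [folklore] -/
theorem partialDeriv_cosCoord (j i : d) (z : UnitAddTorus d) :
    partialDeriv j (cosCoord i) z = if i = j then -(2 * π) * sinCoord j z else 0 := by
  obtain ⟨x, hx⟩ := exists_coe_eq (z i)
  rw [partialDeriv, Torus.lineDeriv]
  by_cases hij : i = j
  · subst hij
    have hline : (fun t : ℝ => cosCoord i (z + proj (t • EuclideanSpace.single i (1 : ℝ)))) =
        fun t => Real.cos (2 * π * (x + t)) := by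
      funext t
      refine cosCoord_of_eq ?_
      rw [line_apply, if_pos rfl, ← hx]; norm_cast
    have hd : HasDerivAt (fun t : ℝ => Real.cos (2 * π * (x + t)))
        (-Real.sin (2 * π * (x + 0)) * (2 * π * 1)) 0 :=
      (((hasDerivAt_id (0 : ℝ)).const_add x).const_mul (2 * π)).cos
    rw [hline, hd.deriv, if_pos rfl, sinCoord_of_eq hx.symm]
    ring_nf
  · have hline : (fun t : ℝ => cosCoord i (z + proj (t • EuclideanSpace.single j (1 : ℝ)))) =
        fun _ => cosCoord i z := by
      funext t
      unfold cosCoord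
      rw [line_apply, if_neg hij]
      simp
    rw [hline, deriv_const, if_neg hij]

/-- **`∂ⱼ sin(2π zᵢ)`**: `2π cos(2π zⱼ)` if `i = j`, else `0`. [folklore] -/
theorem partialDeriv_sinCoord (j i : d) (z : UnitAddTorus d) :
    partialDeriv j (sinCoord i) z = if i = j then (2 * π) * cosCoord j z else 0 := by
  obtain ⟨x, hx⟩ := exists_coe_eq (z i)
  rw [partialDeriv, Torus.lineDeriv]
  by_cases hij : i = j
  · subst hij
    have hline : (fun t : ℝ => sinCoord i (z + proj (t • EuclideanSpace.single i (1 : ℝ)))) =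
        fun t => Real.sin (2 * π * (x + t)) := by
      funext t
      refine sinCoord_of_eq ?_
      rw [line_apply, if_pos rfl, ← hx]; norm_cast
    have hd : HasDerivAt (fun t : ℝ => Real.sin (2 * π * (x + t)))
        (Real.cos (2 * π * (x + 0)) * (2 * π * 1)) 0 :=
      (((hasDerivAt_id (0 : ℝ)).const_add x).const_mul (2 * π)).sin
    rw [hline, hd.deriv, if_pos rfl, cosCoord_of_eq hx.symm]
    ring_nf
  · have hline : (fun t : ℝ => sinCoord i (z + proj (t • EuclideanSpace.single j (1 : ℝ)))) =
        fun _ => sinCoord i z := by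
      funext t
      unfold sinCoord
      rw [line_apply, if_neg hij]
      simp
    rw [hline, deriv_const, if_neg hij]

/-- The partial derivative of a finite sum of smooth functions. [folklore] -/
theorem partialDeriv_fun_sum {ι : Type*} (T : Finset ι) {f : ι → UnitAddTorus d → ℝ}
    (hf : ∀ k ∈ T, IsSmooth (f k)) (j : d) (z : UnitAddTorus d) :
    partialDeriv j (fun y => ∑ k ∈ T, f k y) z = ∑ k ∈ T, partialDeriv j (f k) z := by
  rw [partialDeriv, Torus.lineDeriv]
  have h := deriv_fun_sum (x := (0 : ℝ)) (u := T) (A := fun k (t : ℝ) => f k (z + proj (t • EuclideanSpace.single j (1 : ℝ))))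
    (fun k hk => ((hf k hk).hasDerivAt_line_zero j z).differentiableAt)
  rw [h]
  exact Finset.sum_congr rfl fun k hk => ((hf k hk).hasDerivAt_line_zero j z).deriv

/-- **`∂ⱼ S = π sin(2π zⱼ)`**. [folklore] -/
theorem partialDeriv_sinSqSum (j : d) (z : UnitAddTorus d) : partialDeriv j sinSqSum z = π * sinCoord j z := by
  have h : (sinSqSum : UnitAddTorus d → ℝ) = fun y => ∑ i, (fun i y => (1 - cosCoord i y) / 2) i y := rfl
  have hsm : ∀ i ∈ (Finset.univ : Finset d), IsSmooth (fun y : UnitAddTorus d => (1 - cosCoord i y) / 2) :=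
    fun i _ => by
      have := ((isSmooth_const (1 : ℝ)).sub (isSmooth_cosCoord i)).smul (1 / 2 : ℝ)
      convert this using 1
      funext y; simp [div_eq_inv_mul]
  rw [h, partialDeriv_fun_sum Finset.univ hsm]
  have hterm : ∀ i, partialDeriv j (fun y : UnitAddTorus d => (1 - cosCoord i y) / 2) z =
      (0 - partialDeriv j (cosCoord i) z) / 2 := by
    intro i
    rw [partialDeriv, Torus.lineDeriv]
    have h1 := ((isSmooth_cosCoord i).hasDerivAt_line_zero j z)
    have h2 : HasDerivAt (fun t : ℝ => (1 - cosCoord i (z + proj (t • EuclideanSpace.single j (1 : ℝ)))) / 2)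
        ((0 - partialDeriv j (cosCoord i) z) / 2) 0 := ((hasDerivAt_const (0 : ℝ) (1 : ℝ)).sub h1).div_const 2
    exact h2.deriv
  simp_rw [hterm, partialDeriv_cosCoord]
  rw [Finset.sum_eq_single j]
  · simp; ring
  · intro i _ hij; simp [hij]
  · intro h; exact absurd (Finset.mem_univ j) h

/-- **`∂ⱼ (π sin(2π zⱼ)) = 2π² cos(2π zⱼ)`** — the pure second derivatives of `S`. [folklore] -/
theorem partialDeriv_partialDeriv_sinSqSum (j : d) (z : UnitAddTorus d) :
    partialDeriv j (partialDeriv j sinSqSum) z = 2 * π ^ 2 * cosCoord j z := by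
  have h : (partialDeriv j sinSqSum : UnitAddTorus d → ℝ) = fun y => π * sinCoord j y :=
    funext (partialDeriv_sinSqSum j)
  rw [h, partialDeriv, Torus.lineDeriv]
  have h1 := ((isSmooth_sinCoord j).hasDerivAt_line_zero j z (d := d))
  rw [(h1.const_mul π).deriv, partialDeriv_sinCoord, if_pos rfl]
  ring

/-- `∂ⱼ∂ⱼ S ≤ 2π²`. [folklore] -/
theorem partialDeriv_partialDeriv_sinSqSum_le (j : d) (z : UnitAddTorus d) :
    partialDeriv j (partialDeriv j sinSqSum) z ≤ 2 * π ^ 2 := by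
  rw [partialDeriv_partialDeriv_sinSqSum]
  nlinarith [cosCoord_le_one j z, Real.pi_pos, sq_nonneg π]

/-- **`∑ⱼ (∂ⱼS)² ≤ 4π² S`**. [folklore] -/
theorem sum_sq_partialDeriv_sinSqSum_le (z : UnitAddTorus d) :
    ∑ j, partialDeriv j sinSqSum z ^ 2 ≤ 4 * π ^ 2 * sinSqSum z := by
  simp_rw [partialDeriv_sinSqSum]
  exact sum_sq_pi_mul_sinCoord_le z

/-- `∂ⱼ S` is odd. [folklore] -/
theorem partialDeriv_sinSqSum_neg (j : d) (z : UnitAddTorus d) :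
    partialDeriv j sinSqSum (-z) = -partialDeriv j sinSqSum z := by
  rw [partialDeriv_sinSqSum, partialDeriv_sinSqSum, sinCoord_neg, mul_neg]

/-- The gradient of `S` in coordinates. [folklore] -/
theorem gradient_sinSqSum_apply (z : UnitAddTorus d) (j : d) :
    Torus.gradient sinSqSum z j = π * sinCoord j z := by
  rw [gradient_apply (isSmooth_sinSqSum.isContDiff (by simp)), partialDeriv_sinSqSum]

/-- `‖∇S‖² ≤ 4π² S`. [folklore] -/
theorem norm_gradient_sinSqSum_sq_le (z : UnitAddTorus d) :
    ‖Torus.gradient sinSqSum z‖ ^ 2 ≤ 4 * π ^ 2 * sinSqSum z := by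
  rw [EuclideanSpace.norm_sq_eq]
  calc ∑ j, ‖Torus.gradient sinSqSum z j‖ ^ 2 = ∑ j, (π * sinCoord j z) ^ 2 :=
        Finset.sum_congr rfl fun j _ => by rw [gradient_sinSqSum_apply, Real.norm_eq_abs, sq_abs]
    _ ≤ 4 * π ^ 2 * sinSqSum z := sum_sq_pi_mul_sinCoord_le z

/-- The gradient of `S` is odd. [folklore] -/
theorem gradient_sinSqSum_neg (z : UnitAddTorus d) : Torus.gradient sinSqSum (-z) = -Torus.gradient sinSqSum z := by
  ext j
  rw [PiLp.neg_apply, gradient_sinSqSum_apply, gradient_sinSqSum_apply, sinCoord_neg, mul_neg]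

/-! ## Derivatives of the logarithmic cost -/


omit [Fintype d] [DecidableEq d] in
/-- The base point of a coordinate line. [folklore] -/
theorem line_zero [Fintype d] (z : UnitAddTorus d) (v : EuclideanSpace ℝ d) : z + proj ((0 : ℝ) • v) = z := by
  rw [zero_smul, proj_zero, add_zero]

/-- **`∂ⱼ Φ_δ = (∂ⱼS/δ²)/(1 + S/δ²)`**. [folklore] -/
theorem partialDeriv_sinLogCost (δ : ℝ) (j : d) (z : UnitAddTorus d) :
    partialDeriv j (sinLogCost δ) z = (partialDeriv j sinSqSum z / δ ^ 2) / (1 + sinSqSum z / δ ^ 2) := by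
  have h1 := (isSmooth_sinSqSum (d := d)).hasDerivAt_line_zero j z
  have h2 : HasDerivAt (fun t : ℝ => 1 + sinSqSum (z + proj (t • EuclideanSpace.single j (1 : ℝ))) / δ ^ 2)
      (0 + partialDeriv j sinSqSum z / δ ^ 2) 0 := (h1.div_const _).const_add 1 |>.congr_deriv (by ring)
  have hne : 1 + sinSqSum (z + proj ((0 : ℝ) • EuclideanSpace.single j (1 : ℝ))) / δ ^ 2 ≠ 0 := by
    rw [line_zero]; exact (one_add_sinSqSum_div_pos z).ne'
  have h3 := h2.log hne
  rw [line_zero, zero_add] at h3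
  rw [partialDeriv, Torus.lineDeriv]
  exact h3.deriv

/-- The gradient of `Φ_δ` in coordinates. [folklore] -/
theorem gradient_sinLogCost_apply (δ : ℝ) (z : UnitAddTorus d) (j : d) :
    Torus.gradient (sinLogCost δ) z j = (1 / δ ^ 2) / (1 + sinSqSum z / δ ^ 2) * (π * sinCoord j z) := by
  rw [gradient_apply ((isSmooth_sinLogCost δ).isContDiff (by simp)), partialDeriv_sinLogCost, partialDeriv_sinSqSum]
  ring

/-- **`∇Φ_δ = (δ⁻²/(1 + S/δ²)) ∇S`**. [folklore] -/
theorem gradient_sinLogCost (δ : ℝ) (z : UnitAddTorus d) :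
    Torus.gradient (sinLogCost δ) z = ((1 / δ ^ 2) / (1 + sinSqSum z / δ ^ 2)) • Torus.gradient sinSqSum z := by
  ext j
  rw [gradient_sinLogCost_apply, PiLp.smul_apply, gradient_sinSqSum_apply, smul_eq_mul]

/-- The gradient of `Φ_δ` is odd. [folklore] -/
theorem gradient_sinLogCost_neg (δ : ℝ) (z : UnitAddTorus d) :
    Torus.gradient (sinLogCost δ) (-z) = -Torus.gradient (sinLogCost δ) z := by
  rw [gradient_sinLogCost, gradient_sinLogCost, sinSqSum_neg, gradient_sinSqSum_neg, smul_neg]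

/-- `‖∇S‖ ≤ 2π √S`. [folklore] -/
theorem norm_gradient_sinSqSum_le (z : UnitAddTorus d) :
    ‖Torus.gradient sinSqSum z‖ ≤ 2 * π * Real.sqrt (sinSqSum z) := by
  have h := norm_gradient_sinSqSum_sq_le z
  have h2 : (2 * π * Real.sqrt (sinSqSum z)) ^ 2 = 4 * π ^ 2 * sinSqSum z := by
    rw [mul_pow, mul_pow, Real.sq_sqrt (sinSqSum_nonneg z)]; ring
  rw [← h2] at h
  have h' := abs_le_of_sq_le_sq h (by positivity)
  rwa [abs_of_nonneg (norm_nonneg _)] at h'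

/-- **The transport bound**: `‖z‖ · ‖∇Φ_δ(z)‖ ≤ π` (`δ ≠ 0`). This is what makes
`|(u(x) - u(y))·∇Φ_δ(x - y)| ≤ π (Mu(x) + Mu(y))` for the two-point maximal function `Mu`.
[folklore] -/
theorem norm_mul_norm_gradient_sinLogCost_le {δ : ℝ} (hδ : δ ≠ 0) (z : UnitAddTorus d) :
    ‖z‖ * ‖Torus.gradient (sinLogCost δ) z‖ ≤ π := by
  set s := sinSqSum z with hs
  have hs0 : 0 ≤ s := sinSqSum_nonneg z
  have hδ2 : 0 < δ ^ 2 := by positivity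
  set c : ℝ := (1 / δ ^ 2) / (1 + s / δ ^ 2) with hc
  have hden : 0 < 1 + s / δ ^ 2 := one_add_sinSqSum_div_pos z
  have hc0 : 0 ≤ c := by positivity
  have h1 : ‖Torus.gradient (sinLogCost δ) z‖ ≤ c * (2 * π * Real.sqrt s) := by
    rw [gradient_sinLogCost, norm_smul, Real.norm_of_nonneg hc0]
    exact mul_le_mul_of_nonneg_left (norm_gradient_sinSqSum_le z) hc0
  have h2 : ‖z‖ ≤ Real.sqrt s / 2 := norm_le_sqrt_sinSqSum_div_two z
  calc ‖z‖ * ‖Torus.gradient (sinLogCost δ) z‖ ≤ (Real.sqrt s / 2) * (c * (2 * π * Real.sqrt s)) :=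
        mul_le_mul h2 h1 (norm_nonneg _) (by positivity)
    _ = π * (c * s) := by
        have : Real.sqrt s * Real.sqrt s = s := Real.mul_self_sqrt hs0
        linear_combination (π * c) * this
    _ ≤ π * 1 := by
        refine mul_le_mul_of_nonneg_left ?_ Real.pi_pos.le
        rw [hc, div_mul_eq_mul_div, div_le_one hden]
        have : 1 / δ ^ 2 * s = s / δ ^ 2 := by ring
        linarith
    _ = π := mul_one π

/-- The pure second derivatives of `Φ_δ`:
`∂ⱼ∂ⱼΦ_δ = ((∂ⱼ∂ⱼS/δ²)(1 + S/δ²) - (∂ⱼS/δ²)²)/(1 + S/δ²)²`. [folklore] -/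
theorem partialDeriv_partialDeriv_sinLogCost (δ : ℝ) (j : d) (z : UnitAddTorus d) :
    partialDeriv j (partialDeriv j (sinLogCost δ)) z =
      ((partialDeriv j (partialDeriv j sinSqSum) z / δ ^ 2) * (1 + sinSqSum z / δ ^ 2) -
        (partialDeriv j sinSqSum z / δ ^ 2) * (partialDeriv j sinSqSum z / δ ^ 2)) /
        (1 + sinSqSum z / δ ^ 2) ^ 2 := by
  have hG : (partialDeriv j (sinLogCost δ) : UnitAddTorus d → ℝ) =
      fun y => (partialDeriv j sinSqSum y / δ ^ 2) / (1 + sinSqSum y / δ ^ 2) :=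
    funext (partialDeriv_sinLogCost δ j)
  rw [hG, partialDeriv, Torus.lineDeriv]
  have hN := ((isSmooth_sinSqSum (d := d)).partialDeriv j).hasDerivAt_line_zero j z
  have hD := (isSmooth_sinSqSum (d := d)).hasDerivAt_line_zero j z
  have hN' : HasDerivAt (fun t : ℝ => partialDeriv j sinSqSum (z + proj (t • EuclideanSpace.single j (1 : ℝ))) / δ ^ 2)
      (partialDeriv j (partialDeriv j sinSqSum) z / δ ^ 2) 0 := hN.div_const _
  have hD' : HasDerivAt (fun t : ℝ => 1 + sinSqSum (z + proj (t • EuclideanSpace.single j (1 : ℝ))) / δ ^ 2)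
      (0 + partialDeriv j sinSqSum z / δ ^ 2) 0 := (hD.div_const _).const_add 1 |>.congr_deriv (by ring)
  have hne : 1 + sinSqSum (z + proj ((0 : ℝ) • EuclideanSpace.single j (1 : ℝ))) / δ ^ 2 ≠ 0 := by
    rw [line_zero]; exact (one_add_sinSqSum_div_pos z).ne'
  have h := hN'.div hD' hne
  simp only [line_zero, zero_add] at h
  exact h.deriv

/-- `|∂ⱼ∂ⱼS| ≤ 2π²`. [folklore] -/
theorem abs_partialDeriv_partialDeriv_sinSqSum_le (j : d) (z : UnitAddTorus d) :
    |partialDeriv j (partialDeriv j sinSqSum) z| ≤ 2 * π ^ 2 := by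
  rw [partialDeriv_partialDeriv_sinSqSum, abs_mul, abs_of_pos (by positivity)]
  have := abs_cosCoord_le j z
  nlinarith [Real.pi_pos, sq_nonneg π]

/-- **`∂ⱼ∂ⱼΦ_δ ≤ 2π²/δ²`** (`δ ≠ 0`). [folklore] -/
theorem partialDeriv_partialDeriv_sinLogCost_le {δ : ℝ} (hδ : δ ≠ 0) (j : d) (z : UnitAddTorus d) :
    partialDeriv j (partialDeriv j (sinLogCost δ)) z ≤ 2 * π ^ 2 / δ ^ 2 := by
  rw [partialDeriv_partialDeriv_sinLogCost]
  set D := 1 + sinSqSum z / δ ^ 2 with hD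
  set a := partialDeriv j (partialDeriv j sinSqSum) z / δ ^ 2 with ha
  set b := partialDeriv j sinSqSum z / δ ^ 2 with hb
  have hDpos : 0 < D := one_add_sinSqSum_div_pos z
  have hD1 : 1 ≤ D := by
    have := div_nonneg (sinSqSum_nonneg z) (sq_nonneg δ); rw [hD]; linarith
  have hδ2 : 0 < δ ^ 2 := by positivity
  have habs : |a| ≤ 2 * π ^ 2 / δ ^ 2 := by
    rw [ha, abs_div, abs_of_pos hδ2]
    exact div_le_div_of_nonneg_right (abs_partialDeriv_partialDeriv_sinSqSum_le j z) hδ2.le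
  calc (a * D - b * b) / D ^ 2 ≤ a * D / D ^ 2 := by
        apply div_le_div_of_nonneg_right _ (by positivity); nlinarith [sq_nonneg b]
    _ = a / D := by field_simp
    _ ≤ |a| / D := div_le_div_of_nonneg_right (le_abs_self a) hDpos.le
    _ ≤ |a| := div_le_self (abs_nonneg a) hD1
    _ ≤ 2 * π ^ 2 / δ ^ 2 := habs

/-- **The diffusion bound**: `ΔΦ_δ ≤ 2π² d/δ²` (`δ ≠ 0`). [folklore] -/
theorem laplacian_sinLogCost_le {δ : ℝ} (hδ : δ ≠ 0) (z : UnitAddTorus d) :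
    Torus.laplacian (sinLogCost δ) z ≤ 2 * π ^ 2 * Fintype.card d / δ ^ 2 := by
  rw [laplacian_eq_sum_partialDeriv_partialDeriv (isSmooth_sinLogCost δ)]
  calc ∑ j, partialDeriv j (partialDeriv j (sinLogCost δ)) z ≤ ∑ _j : d, 2 * π ^ 2 / δ ^ 2 :=
        Finset.sum_le_sum fun j _ => partialDeriv_partialDeriv_sinLogCost_le hδ j z
    _ = 2 * π ^ 2 * Fintype.card d / δ ^ 2 := by
        rw [Finset.sum_const, Finset.card_univ, nsmul_eq_mul]; ring

omit [DecidableEq d] in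
/-- The Laplacian of `Φ_δ` is continuous (hence integrable, bounded). [folklore] -/
theorem continuous_laplacian_sinLogCost (δ : ℝ) : Continuous (Torus.laplacian (sinLogCost δ) : UnitAddTorus d → ℝ) :=
  (isSmooth_sinLogCost δ).laplacian.continuous

omit [DecidableEq d] in
/-- The gradient of `Φ_δ` is continuous. [folklore] -/
theorem continuous_gradient_sinLogCost (δ : ℝ) : Continuous (Torus.gradient (sinLogCost δ) : UnitAddTorus d → EuclideanSpace ℝ d) :=
  (isSmooth_sinLogCost δ).gradient.continuous

end Torus

end Literature.Analysis.FunctionSpaces
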